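import Mathlib

/-!
# `BalabanUV.Beta.GAN24.ResolventDifference` — binder row G-an2-4 / (CONV-C), road P1-fibre, leaf **P1-L11a** of
# `LEMMAS.md` § GAN24 SKELETON-P1 LEAF CLAIM TABLE: the resolvent-difference / perturbed-inverse algebra for the
# `(D+1)×(D+1)` capacitance matrices (dependency-free sub-part of P1-L11 = `SKELETON-P1.md` §4 step B3)

NOT IN PRINT; OUR PROOF ATTEMPT.  HONEST FRAMING (cell contract, verbatim): «discharging `BetaPertH` makes Bałaban's UV
stability UNCONDITIONAL — a real constructive-QFT result; it is NOT the continuum limit and NOT the Clay problem.»  HONEST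
DEPENDENCY (verbatim): «continuum YM on T⁴ ⇐ BetaPertH ∧ nine spine estimates (0/9 proved); BetaPertH ⇐ (D1) ∧ (D4) ∧ CAP+tail;
G-an2-4 gates asym, D1 and NE2/3/4.»  [folklore] finite-dimensional matrix algebra over a normed field (no cited fact, no
wall binder, no `def`, no constant by hand).  NOT summit progress.

## What is proved (for square matrices over a finite index type `n`)
* §1 `inv_sub_inv`, `inv_sub_inv'`: the **resolvent identity** `A⁻¹ − B⁻¹ = A⁻¹ (B − A) B⁻¹ = B⁻¹ (B − A) A⁻¹` for units
  `A`, `B` over ANY commutative ring (the tree's `King1986.CovarianceRate.inv_sub_inv_of_isUnit` is the `ℝ` instance with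
  the same proof; it is not imported because its statement is `Matrix n n ℝ`, whereas the capacitance matrices are complex).
* §2 `norm_mul_mul_apply_le`: entrywise size of a triple product, `‖(X Y Z) i j‖ ≤ (card n)²·x·y·z`; hence the
  **entrywise resolvent-difference bound** `norm_inv_sub_inv_apply_le`:
  `(∀ i j, ‖A⁻¹ i j‖ ≤ a) → (∀ i j, ‖B⁻¹ i j‖ ≤ b) → (∀ i j, ‖(A − B) i j‖ ≤ ε) → ∀ i j, ‖(A⁻¹ − B⁻¹) i j‖ ≤ (card n)²·a·ε·b`.
* §3 the **perturbed-inverse (Neumann) bound**, proved WITHOUT series by the a-priori `ℓ^∞` estimate for the fixed point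
  `B⁻¹ = A⁻¹ + (A⁻¹(A − B)) B⁻¹` (`norm_apply_le_of_fixedPoint`), valid over every normed field (`ℝ`, `ℂ`):
  - sharp row-sum form `isUnit_and_norm_inv_apply_le`: `Σ_j ‖A⁻¹ i j‖ ≤ α`, `‖A⁻¹ i j‖ ≤ a`, `Σ_j ‖(A − B) i j‖ ≤ η`,
    `α·η < 1` ⇒ `B` is a unit and `‖B⁻¹ i j‖ ≤ a/(1 − α·η)`;
  - the table row's constants under the OPERATOR-NORM reading of its hypothesis `‖A⁻¹‖ ≤ a` (max row sum = Mathlib's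
    `Matrix.linftyOpNorm`), `isUnit_and_norm_inv_apply_le_of_rowSum`: `card n·a·ε < 1` ⇒ `‖B⁻¹ i j‖ ≤ a/(1 − card n·a·ε)`;
  - the purely ENTRYWISE form `isUnit_and_norm_inv_apply_le_of_entrywise`: `(card n)²·a·ε < 1` ⇒
    `‖B⁻¹ i j‖ ≤ a/(1 − (card n)²·a·ε)`, and the one-sided-data difference bound `norm_inv_sub_inv_apply_le_of_entrywise`
    (only `A⁻¹` and `A − B` controlled — the shape of the rate step `Cap_{j+1}(p)` versus `Cap_j(p)` and of the strip
    perturbation of `Cap`).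
* §4 `entrywise_reading_needs_square`: a `2×2` real WITNESS that with entrywise data the square in `(card n)²` cannot be
  dropped: `A⁻¹ = [[1/2,1],[1,1/2]]` (entries `≤ 1`), `A − B = (1/3)·J` (`ε = 1/3`, `card n·a·ε = 2/3 < 1`), yet
  `B = [[−1,1],[1,−1]]` is singular.  (So the row's `card n·a·ε` is correct exactly under the operator-norm reading, which is
  the one formalised in `…_of_rowSum`.)
* §5 the SCALAR currency (`1×1` case, for differences of scalar alias sums): `norm_inv_le_of_norm_sub_le`
  (`a ≠ 0`, `‖a⁻¹‖ ≤ α`, `‖a − b‖ ≤ ε`, `α·ε < 1` ⇒ `b ≠ 0`, `‖b⁻¹‖ ≤ α/(1 − α·ε)`) and `norm_inv_sub_inv_le`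
  (`‖a⁻¹ − b⁻¹‖ ≤ α·ε·β`, from Mathlib's `inv_sub_inv'`).
-/

open Finset
open scoped BigOperators

namespace Summit.QuantumFields.BalabanUV.Beta.GAN24.ResolventDifference

variable {n : Type*} [Fintype n]

section Identity

variable [DecidableEq n] {R : Type*} [CommRing R]

/-- [folklore] **Resolvent identity** for invertible square matrices over any commutative ring:
`A⁻¹ − B⁻¹ = A⁻¹ (B − A) B⁻¹` (the `ℝ` case is the tree's `King1986.CovarianceRate.inv_sub_inv_of_isUnit`). -/
theorem inv_sub_inv (A B : Matrix n n R) (hA : IsUnit A) (hB : IsUnit B) :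
    A⁻¹ - B⁻¹ = A⁻¹ * (B - A) * B⁻¹ := by
  have hAd : IsUnit A.det := (Matrix.isUnit_iff_isUnit_det A).mp hA
  have hBd : IsUnit B.det := (Matrix.isUnit_iff_isUnit_det B).mp hB
  rw [Matrix.mul_sub, Matrix.sub_mul, Matrix.mul_assoc A⁻¹ B B⁻¹, Matrix.mul_nonsing_inv B hBd,
    Matrix.mul_one, Matrix.nonsing_inv_mul A hAd, Matrix.one_mul]

/-- [folklore] The mirror form of the resolvent identity: `A⁻¹ − B⁻¹ = B⁻¹ (B − A) A⁻¹`. -/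
theorem inv_sub_inv' (A B : Matrix n n R) (hA : IsUnit A) (hB : IsUnit B) :
    A⁻¹ - B⁻¹ = B⁻¹ * (B - A) * A⁻¹ := by
  have hAd : IsUnit A.det := (Matrix.isUnit_iff_isUnit_det A).mp hA
  have hBd : IsUnit B.det := (Matrix.isUnit_iff_isUnit_det B).mp hB
  rw [Matrix.mul_sub, Matrix.sub_mul, Matrix.mul_assoc B⁻¹ A A⁻¹, Matrix.mul_nonsing_inv A hAd,
    Matrix.mul_one, Matrix.nonsing_inv_mul B hBd, Matrix.one_mul]

end Identity

section Bounds

variable {𝕜 : Type*} [NormedField 𝕜]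

/-- [folklore] Entrywise size of a triple product from entrywise bounds of the three factors:
`‖(X Y Z) i j‖ ≤ (card n)² · x · y · z` (no sign hypotheses: they follow from the bounds themselves). -/
theorem norm_mul_mul_apply_le (X Y Z : Matrix n n 𝕜) {x y z : ℝ}
    (hX : ∀ i j, ‖X i j‖ ≤ x) (hY : ∀ i j, ‖Y i j‖ ≤ y) (hZ : ∀ i j, ‖Z i j‖ ≤ z) (i j : n) :
    ‖(X * Y * Z) i j‖ ≤ (Fintype.card n : ℝ) ^ 2 * x * y * z := by
  have hx0 : 0 ≤ x := (norm_nonneg _).trans (hX i j)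
  have hy0 : 0 ≤ y := (norm_nonneg _).trans (hY i j)
  rw [Matrix.mul_apply]
  calc ‖∑ l, (X * Y) i l * Z l j‖ ≤ ∑ l, ‖(X * Y) i l * Z l j‖ := norm_sum_le _ _
    _ ≤ ∑ _l : n, ((Fintype.card n : ℝ) * x * y) * z := by
        refine Finset.sum_le_sum fun l _ => ?_
        rw [norm_mul]
        refine mul_le_mul ?_ (hZ l j) (norm_nonneg _) (mul_nonneg (mul_nonneg (Nat.cast_nonneg _) hx0) hy0)
        rw [Matrix.mul_apply]
        calc ‖∑ k, X i k * Y k l‖ ≤ ∑ k, ‖X i k * Y k l‖ := norm_sum_le _ _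
          _ ≤ ∑ _k : n, x * y := Finset.sum_le_sum fun k _ => by
              rw [norm_mul]; exact mul_le_mul (hX i k) (hY k l) (norm_nonneg _) hx0
          _ = (Fintype.card n : ℝ) * x * y := by
              rw [Finset.sum_const, nsmul_eq_mul, Finset.card_univ, mul_assoc]
    _ = (Fintype.card n : ℝ) ^ 2 * x * y * z := by
        rw [Finset.sum_const, nsmul_eq_mul, Finset.card_univ]; ring

/-- [folklore] Row sums of a product: `Σ_k ‖(P E) i k‖ ≤ (Σ_l ‖P i l‖) · η` when every row sum of `E` is `≤ η`
(submultiplicativity of the max-row-sum norm, written out on `Finset` sums). -/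
theorem rowSum_mul_le (P E : Matrix n n 𝕜) {η : ℝ} (hE : ∀ l, ∑ k, ‖E l k‖ ≤ η) (i : n) :
    ∑ k, ‖(P * E) i k‖ ≤ (∑ l, ‖P i l‖) * η := by
  calc ∑ k, ‖(P * E) i k‖ ≤ ∑ k, ∑ l, ‖P i l‖ * ‖E l k‖ := by
        refine Finset.sum_le_sum fun k _ => ?_
        rw [Matrix.mul_apply]
        exact (norm_sum_le _ _).trans (le_of_eq (Finset.sum_congr rfl fun l _ => norm_mul _ _))
    _ = ∑ l, ‖P i l‖ * ∑ k, ‖E l k‖ := by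
        rw [Finset.sum_comm]; exact Finset.sum_congr rfl fun l _ => (Finset.mul_sum _ _ _).symm
    _ ≤ ∑ l, ‖P i l‖ * η := Finset.sum_le_sum fun l _ => mul_le_mul_of_nonneg_left (hE l) (norm_nonneg _)
    _ = (∑ l, ‖P i l‖) * η := by rw [Finset.sum_mul]

/-- [folklore] **A-priori `ℓ^∞` bound for a fixed point of a row contraction** (the finite-dimensional content of the
Neumann series, with no series): if `Σ_k ‖M i k‖ ≤ q < 1` for every row, `‖y i‖ ≤ s` for every `i`, and
`x i = y i + Σ_k M i k · x k` for every `i`, then `‖x i‖ ≤ s/(1 − q)` for every `i`. -/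
theorem norm_apply_le_of_fixedPoint (M : Matrix n n 𝕜) {q s : ℝ} (hM : ∀ i, ∑ k, ‖M i k‖ ≤ q) (hq : q < 1)
    (x y : n → 𝕜) (hy : ∀ i, ‖y i‖ ≤ s) (hx : ∀ i, x i = y i + ∑ k, M i k * x k) (i : n) :
    ‖x i‖ ≤ s / (1 - q) := by
  obtain ⟨i₀, -, hi₀⟩ := Finset.exists_max_image Finset.univ (fun i => ‖x i‖) ⟨i, Finset.mem_univ i⟩
  have hmax : ∀ k, ‖x k‖ ≤ ‖x i₀‖ := fun k => hi₀ k (Finset.mem_univ k)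
  have key : ‖x i₀‖ ≤ s + q * ‖x i₀‖ := by
    calc ‖x i₀‖ = ‖y i₀ + ∑ k, M i₀ k * x k‖ := by rw [← hx i₀]
      _ ≤ ‖y i₀‖ + ‖∑ k, M i₀ k * x k‖ := norm_add_le _ _
      _ ≤ s + ∑ k, ‖M i₀ k‖ * ‖x i₀‖ := by
          refine add_le_add (hy i₀) ((norm_sum_le _ _).trans (Finset.sum_le_sum fun k _ => ?_))
          rw [norm_mul]
          exact mul_le_mul_of_nonneg_left (hmax k) (norm_nonneg _)
      _ = s + (∑ k, ‖M i₀ k‖) * ‖x i₀‖ := by rw [Finset.sum_mul]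
      _ ≤ s + q * ‖x i₀‖ := by
          refine add_le_add le_rfl (mul_le_mul_of_nonneg_right (hM i₀) (norm_nonneg _))
  have h1q : 0 < 1 - q := sub_pos.mpr hq
  have hi₀' : ‖x i₀‖ ≤ s / (1 - q) := by
    rw [le_div_iff₀ h1q]; nlinarith [key]
  exact (hmax i).trans hi₀'

variable [DecidableEq n]

/-- [folklore] **Entrywise resolvent-difference bound**: if every entry of `A⁻¹` is `≤ a`, of `B⁻¹` is `≤ b` and of `A − B`
is `≤ ε` in norm, then every entry of `A⁻¹ − B⁻¹` is `≤ (card n)²·a·ε·b`. -/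
theorem norm_inv_sub_inv_apply_le (A B : Matrix n n 𝕜) (hA : IsUnit A) (hB : IsUnit B) {a b ε : ℝ}
    (ha : ∀ i j, ‖A⁻¹ i j‖ ≤ a) (hb : ∀ i j, ‖B⁻¹ i j‖ ≤ b) (hε : ∀ i j, ‖(A - B) i j‖ ≤ ε) (i j : n) :
    ‖(A⁻¹ - B⁻¹) i j‖ ≤ (Fintype.card n : ℝ) ^ 2 * a * ε * b := by
  rw [inv_sub_inv A B hA hB]
  refine norm_mul_mul_apply_le A⁻¹ (B - A) B⁻¹ ha (fun k l => ?_) hb i j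
  rw [← neg_sub, Matrix.neg_apply, norm_neg]
  exact hε k l

/-- [folklore] **Perturbed inverse, sharp row-sum form** (Neumann bound, proved by the a-priori estimate): for a unit `A`,
if `Σ_j ‖A⁻¹ i j‖ ≤ α` and `‖A⁻¹ i j‖ ≤ a` for all `i j`, `Σ_j ‖(A − B) i j‖ ≤ η` for all `i`, and `α·η < 1`, then `B`
is a unit and `‖B⁻¹ i j‖ ≤ a/(1 − α·η)` for all `i j`.  Mechanism: with `M = A⁻¹(A − B)` (row sums `≤ α·η`),
`B v = 0 ⇒ v = M v ⇒ v = 0` (so `det B ≠ 0` over a field), and `B⁻¹ = A⁻¹ + M B⁻¹` column by column. -/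
theorem isUnit_and_norm_inv_apply_le (A B : Matrix n n 𝕜) (hA : IsUnit A) {α a η : ℝ}
    (hα : ∀ i, ∑ j, ‖A⁻¹ i j‖ ≤ α) (ha : ∀ i j, ‖A⁻¹ i j‖ ≤ a) (hη : ∀ i, ∑ j, ‖(A - B) i j‖ ≤ η)
    (hq : α * η < 1) :
    IsUnit B ∧ ∀ i j, ‖B⁻¹ i j‖ ≤ a / (1 - α * η) := by
  have hAd : IsUnit A.det := (Matrix.isUnit_iff_isUnit_det A).mp hA
  set M : Matrix n n 𝕜 := A⁻¹ * (A - B) with hMdef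
  have hM : ∀ i, ∑ k, ‖M i k‖ ≤ α * η := by
    intro i
    have hη0 : 0 ≤ η := (Finset.sum_nonneg fun j _ => norm_nonneg _).trans (hη i)
    exact (rowSum_mul_le A⁻¹ (A - B) hη i).trans (mul_le_mul_of_nonneg_right (hα i) hη0)
  have hAB : A⁻¹ * B = 1 - M := by
    rw [hMdef, Matrix.mul_sub, Matrix.nonsing_inv_mul A hAd, sub_sub_cancel]
  have hBU : IsUnit B := by
    rw [Matrix.isUnit_iff_isUnit_det, isUnit_iff_ne_zero, ne_eq, ← Matrix.exists_mulVec_eq_zero_iff]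
    rintro ⟨v, hv, hBv⟩
    apply hv
    have h1 : Matrix.mulVec (A⁻¹ * B) v = 0 := by
      rw [← Matrix.mulVec_mulVec, hBv, Matrix.mulVec_zero]
    rw [hAB, Matrix.sub_mulVec, Matrix.one_mulVec, sub_eq_zero] at h1
    have hfix : ∀ i, v i = (0 : n → 𝕜) i + ∑ k, M i k * v k := by
      intro i
      rw [Pi.zero_apply, zero_add]
      exact congr_fun h1 i
    funext i
    have hi := norm_apply_le_of_fixedPoint M hM hq v 0 (s := 0) (fun _ => by rw [Pi.zero_apply, norm_zero]) hfix i
    rw [zero_div] at hi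
    exact norm_le_zero_iff.mp hi
  refine ⟨hBU, ?_⟩
  have hBd : IsUnit B.det := (Matrix.isUnit_iff_isUnit_det B).mp hBU
  have hC : B⁻¹ = A⁻¹ + M * B⁻¹ := by
    have h2 : (A⁻¹ * B) * B⁻¹ = A⁻¹ := by
      rw [Matrix.mul_assoc, Matrix.mul_nonsing_inv B hBd, Matrix.mul_one]
    rw [hAB, Matrix.sub_mul, Matrix.one_mul] at h2
    rw [← h2, sub_add_cancel]
  intro i j
  refine norm_apply_le_of_fixedPoint M hM hq (fun k => B⁻¹ k j) (fun k => A⁻¹ k j) (fun k => ha k j)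
    (fun k => ?_) i
  have h3 := congr_fun (congr_fun hC k) j
  rw [Matrix.add_apply, Matrix.mul_apply] at h3
  exact h3

/-- [folklore] **The table row's constants, operator-norm reading** of `‖A⁻¹‖ ≤ a` (max row sum, Mathlib's
`Matrix.linftyOpNorm`): `Σ_j ‖A⁻¹ i j‖ ≤ a` for all `i`, `‖(A − B) i j‖ ≤ ε` for all `i j`, `card n·a·ε < 1` ⇒ `B` is
a unit and `‖B⁻¹ i j‖ ≤ a/(1 − card n·a·ε)`. -/
theorem isUnit_and_norm_inv_apply_le_of_rowSum (A B : Matrix n n 𝕜) (hA : IsUnit A) {a ε : ℝ}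
    (ha : ∀ i, ∑ j, ‖A⁻¹ i j‖ ≤ a) (hε : ∀ i j, ‖(A - B) i j‖ ≤ ε)
    (h : (Fintype.card n : ℝ) * a * ε < 1) :
    IsUnit B ∧ ∀ i j, ‖B⁻¹ i j‖ ≤ a / (1 - (Fintype.card n : ℝ) * a * ε) := by
  have ha' : ∀ i j, ‖A⁻¹ i j‖ ≤ a := fun i j =>
    (Finset.single_le_sum (fun k _ => norm_nonneg (A⁻¹ i k)) (Finset.mem_univ j)).trans (ha i)
  have hrow : ∀ i, ∑ j, ‖(A - B) i j‖ ≤ (Fintype.card n : ℝ) * ε := fun i =>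
    calc ∑ j, ‖(A - B) i j‖ ≤ ∑ _j : n, ε := Finset.sum_le_sum fun j _ => hε i j
      _ = (Fintype.card n : ℝ) * ε := by rw [Finset.sum_const, nsmul_eq_mul, Finset.card_univ]
  have e : a * ((Fintype.card n : ℝ) * ε) = (Fintype.card n : ℝ) * a * ε := by ring
  have hq : a * ((Fintype.card n : ℝ) * ε) < 1 := by rw [e]; exact h
  obtain ⟨hB, hb⟩ := isUnit_and_norm_inv_apply_le A B hA ha ha' hrow hq
  exact ⟨hB, fun i j => by rw [← e]; exact hb i j⟩

/-- [folklore] **Perturbed inverse, purely entrywise data** (the square in `(card n)²` is necessary, see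
`entrywise_reading_needs_square`): `‖A⁻¹ i j‖ ≤ a`, `‖(A − B) i j‖ ≤ ε` for all `i j` and `(card n)²·a·ε < 1` ⇒ `B` is
a unit and `‖B⁻¹ i j‖ ≤ a/(1 − (card n)²·a·ε)`. -/
theorem isUnit_and_norm_inv_apply_le_of_entrywise (A B : Matrix n n 𝕜) (hA : IsUnit A) {a ε : ℝ}
    (ha : ∀ i j, ‖A⁻¹ i j‖ ≤ a) (hε : ∀ i j, ‖(A - B) i j‖ ≤ ε)
    (h : (Fintype.card n : ℝ) ^ 2 * a * ε < 1) :
    IsUnit B ∧ ∀ i j, ‖B⁻¹ i j‖ ≤ a / (1 - (Fintype.card n : ℝ) ^ 2 * a * ε) := by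
  have hrow : ∀ {X : Matrix n n 𝕜} {x : ℝ}, (∀ i j, ‖X i j‖ ≤ x) → ∀ i, ∑ j, ‖X i j‖ ≤ (Fintype.card n : ℝ) * x := by
    intro X x hX i
    calc ∑ j, ‖X i j‖ ≤ ∑ _j : n, x := Finset.sum_le_sum fun j _ => hX i j
      _ = (Fintype.card n : ℝ) * x := by rw [Finset.sum_const, nsmul_eq_mul, Finset.card_univ]
  have e : ((Fintype.card n : ℝ) * a) * ((Fintype.card n : ℝ) * ε) = (Fintype.card n : ℝ) ^ 2 * a * ε := by ring
  have hq : ((Fintype.card n : ℝ) * a) * ((Fintype.card n : ℝ) * ε) < 1 := by rw [e]; exact h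
  obtain ⟨hB, hb⟩ := isUnit_and_norm_inv_apply_le A B hA (hrow ha) ha (hrow hε) hq
  exact ⟨hB, fun i j => by rw [← e]; exact hb i j⟩

/-- [folklore] **One-sided-data resolvent-difference bound** (the shape of the rate step `Cap_{j+1}` vs `Cap_j`): with only
`A⁻¹` (entries `≤ a`) and `A − B` (entries `≤ ε`, `(card n)²·a·ε < 1`) controlled, `B` is a unit and
`‖(A⁻¹ − B⁻¹) i j‖ ≤ (card n)²·a·ε · a/(1 − (card n)²·a·ε)`. -/
theorem norm_inv_sub_inv_apply_le_of_entrywise (A B : Matrix n n 𝕜) (hA : IsUnit A) {a ε : ℝ}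
    (ha : ∀ i j, ‖A⁻¹ i j‖ ≤ a) (hε : ∀ i j, ‖(A - B) i j‖ ≤ ε)
    (h : (Fintype.card n : ℝ) ^ 2 * a * ε < 1) (i j : n) :
    ‖(A⁻¹ - B⁻¹) i j‖ ≤
      (Fintype.card n : ℝ) ^ 2 * a * ε * (a / (1 - (Fintype.card n : ℝ) ^ 2 * a * ε)) := by
  obtain ⟨hB, hb⟩ := isUnit_and_norm_inv_apply_le_of_entrywise A B hA ha hε h
  exact norm_inv_sub_inv_apply_le A B hA hB ha hb hε i j

end Bounds

section Witness

/-- [folklore] WITNESS: with purely ENTRYWISE data the constant `card n·a·ε` of the operator-norm reading is NOT enough —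
`A = [[−2/3, 4/3],[4/3, −2/3]]` has `A⁻¹ = [[1/2, 1],[1, 1/2]]` (entries `≤ 1 = a`), `A − B = (1/3)·J` (`ε = 1/3`,
`card n·a·ε = 2/3 < 1`), and `B = [[−1, 1],[1, −1]]` is singular. -/
theorem entrywise_reading_needs_square :
    ∃ A B : Matrix (Fin 2) (Fin 2) ℝ, IsUnit A ∧ (∀ i j, ‖A⁻¹ i j‖ ≤ 1) ∧ (∀ i j, ‖(A - B) i j‖ ≤ 1 / 3)
      ∧ (Fintype.card (Fin 2) : ℝ) * 1 * (1 / 3) < 1 ∧ ¬ IsUnit B := by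
  refine ⟨!![-2/3, 4/3; 4/3, -2/3], !![-1, 1; 1, -1], ?_, ?_, ?_, ?_, ?_⟩
  · have h : (!![-2/3, 4/3; 4/3, -2/3] : Matrix (Fin 2) (Fin 2) ℝ) * !![1/2, 1; 1, 1/2] = 1 := by
      ext i j; fin_cases i <;> fin_cases j <;> norm_num [Matrix.mul_apply, Fin.sum_univ_two]
    exact (Matrix.isUnit_iff_isUnit_det _).mpr (Matrix.isUnit_det_of_right_inverse h)
  · have h : (!![-2/3, 4/3; 4/3, -2/3] : Matrix (Fin 2) (Fin 2) ℝ) * !![1/2, 1; 1, 1/2] = 1 := by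
      ext i j; fin_cases i <;> fin_cases j <;> norm_num [Matrix.mul_apply, Fin.sum_univ_two]
    intro i j
    rw [Matrix.inv_eq_right_inv h, Real.norm_eq_abs, abs_le]
    fin_cases i <;> fin_cases j <;> norm_num
  · intro i j
    rw [Real.norm_eq_abs, abs_le]
    fin_cases i <;> fin_cases j <;> norm_num [Matrix.sub_apply]
  · norm_num
  · intro hB
    have hd := (Matrix.isUnit_iff_isUnit_det _).mp hB
    rw [Matrix.det_fin_two_of] at hd
    norm_num at hd

end Witness

section Scalar

variable {𝕜 : Type*} [NormedField 𝕜]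

/-- [folklore] **Scalar perturbed inverse** (the `1×1` currency of §3, for differences of scalar alias sums): in a normed
field, `a ≠ 0`, `‖a⁻¹‖ ≤ α`, `‖a − b‖ ≤ ε`, `α·ε < 1` ⇒ `b ≠ 0` and `‖b⁻¹‖ ≤ α/(1 − α·ε)`.  No series: `b⁻¹ = a⁻¹ + m·b⁻¹`
with `m = a⁻¹(a − b)`, `‖m‖ ≤ α·ε`. -/
theorem norm_inv_le_of_norm_sub_le {a b : 𝕜} {α ε : ℝ} (ha : a ≠ 0) (hα : ‖a⁻¹‖ ≤ α) (hε : ‖a - b‖ ≤ ε)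
    (hq : α * ε < 1) : b ≠ 0 ∧ ‖b⁻¹‖ ≤ α / (1 - α * ε) := by
  have hm : ‖a⁻¹ * (a - b)‖ ≤ α * ε := by
    rw [norm_mul]; exact mul_le_mul hα hε (norm_nonneg _) ((norm_nonneg _).trans hα)
  have hb : b ≠ 0 := by
    rintro rfl
    rw [sub_zero, inv_mul_cancel₀ ha, norm_one] at hm
    linarith
  refine ⟨hb, ?_⟩
  have hfix : b⁻¹ = a⁻¹ + a⁻¹ * (a - b) * b⁻¹ := by
    field_simp
    ring
  have key : ‖b⁻¹‖ ≤ α + α * ε * ‖b⁻¹‖ := by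
    calc ‖b⁻¹‖ = ‖a⁻¹ + a⁻¹ * (a - b) * b⁻¹‖ := by rw [← hfix]
      _ ≤ ‖a⁻¹‖ + ‖a⁻¹ * (a - b) * b⁻¹‖ := norm_add_le _ _
      _ ≤ α + α * ε * ‖b⁻¹‖ := by
          rw [norm_mul]; exact add_le_add hα (mul_le_mul_of_nonneg_right hm (norm_nonneg _))
  have h1q : 0 < 1 - α * ε := sub_pos.mpr hq
  rw [le_div_iff₀ h1q]; nlinarith [key]

/-- [folklore] **Scalar resolvent-difference bound**: `a, b ≠ 0`, `‖a⁻¹‖ ≤ α`, `‖b⁻¹‖ ≤ β`, `‖a − b‖ ≤ ε` ⇒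
`‖a⁻¹ − b⁻¹‖ ≤ α·ε·β` (Mathlib's `inv_sub_inv'`: `a⁻¹ − b⁻¹ = a⁻¹ (b − a) b⁻¹`). -/
theorem norm_inv_sub_inv_le {a b : 𝕜} {α β ε : ℝ} (ha : a ≠ 0) (hb : b ≠ 0) (hα : ‖a⁻¹‖ ≤ α) (hβ : ‖b⁻¹‖ ≤ β)
    (hε : ‖a - b‖ ≤ ε) : ‖a⁻¹ - b⁻¹‖ ≤ α * ε * β := by
  rw [_root_.inv_sub_inv' ha hb, norm_mul, norm_mul, ← neg_sub, norm_neg]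
  have hα0 : 0 ≤ α := (norm_nonneg _).trans hα
  exact mul_le_mul (mul_le_mul hα hε (norm_nonneg _) hα0) hβ (norm_nonneg _)
    (mul_nonneg hα0 ((norm_nonneg _).trans hε))

end Scalar

end Summit.QuantumFields.BalabanUV.Beta.GAN24.ResolventDifference
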